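import Mathlib
import Literature.LinearAlgebra.Matrix.CrossInterpolation
import Literature.LinearAlgebra.Matrix.MaximalVolumeErrorBounds
import Literature.LinearAlgebra.Matrix.AdaptiveCrossApproximation
import Literature.LinearAlgebra.Matrix.MinkowskiDet

/-!
# Cross approximation of symmetric positive semidefinite matrices

For a real SYMMETRIC POSITIVE SEMIDEFINITE (SPSD) matrix `A` the cross (skeleton) approximation
`Ã = A[:, r] A[r, r]⁻¹ A[r, :]` (`Literature.LinearAlgebra.Matrix.crossInterp A r r`) built on a
PRINCIPAL pivot block `P = A[r, r]` is the partial (pivoted) Cholesky / outer-product `LDLᵀ`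
approximation of [GolubVanLoan2013, §4.2.7–§4.2.8, Algorithm 4.2.2, Theorem 4.2.8] and of
[HarbrechtPetersSchneider2012] (as reported in [CortinovisKressnerMassei2020, §3.2]); its
residual `A - Ã` is the Schur complement `A/A[r, r]`, again SPSD [HornJohnson2013, (7.7.5)],
[CortinovisKressnerMassei2020, Remark 5].  Three consequences organise the
subject and are formalised here (real matrices, finite index types):

* THE DIAGONAL CERTIFICATE.  An SPSD matrix has its entry of largest modulus on the diagonal
  ([GolubVanLoan2013, Theorem 4.2.8, (4.2.12)–(4.2.15)]; [HornJohnson2013, 7.1.P1,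
  Observation 7.1.10]): `(A i j)² ≤ A i i · A j j`, `2|A i j| ≤ A i i + A j j`,
  `|A i j| ≤ max (A i i) (A j j) ≤ trace A`, and `A i i = 0` forces the `i`-th row and column to
  vanish.  Applied to the residual `S = A - Ã` (`posSemidef_sub_crossInterp`): the Chebyshev
  error `max |S i j|` of a principal cross approximation is READ OFF THE `n` RESIDUAL DIAGONALS
  `d_x = S x x ≥ 0` (`abs_sub_crossInterp_le_max_diag`, `abs_sub_crossInterp_le_of_diag_le`,
  `abs_sub_crossInterp_le_trace`), the residual diagonals never exceed the original ones and the
  growth factor is one (`abs_sub_crossInterp_le_max_diag_self`; [CortinovisKressnerMassei2020,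
  §3.2: "`ρ_k = 1`"]), and `Ã = A` as soon as all `d_x` vanish
  (`crossInterp_eq_self_of_forall_diag_eq_zero`; [GolubVanLoan2013, (4.2.15)–(4.2.17)]).
* DIAGONAL PIVOTING.  One more principal pivot `p` updates `d_x ↦ d_x - S x p ² / S p p`
  ([GolubVanLoan2013, §4.2.7–§4.2.8]; `sub_crossInterp_vecCons_self_diag_eq`), so the residual
  diagonals and the pivots are non-increasing ([CortinovisKressnerMassei2020, §3.2];
  `sub_crossInterp_vecCons_self_diag_le`, `_le_pivot`) and the trace drops by at least the pivot
  (`trace_sub_crossInterp_vecCons_self_le`).  Choosing `p` to maximise the residual DIAGONAL is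
  complete pivoting ([CortinovisKressnerMassei2020, Remark 5]: "the search for the pivot element
  can be restricted to the diagonal"): the inductive predicate `IsDiagPivoted` records such pivot
  sequences and `IsDiagPivoted.isRookPivoted` places them under
  `Literature.LinearAlgebra.Matrix.IsRookPivoted`, whence nonsingular pivot blocks, the `2^s`
  coefficient growth bounds of [Bebendorf2000, Lemma 6] (`IsDiagPivoted.norm_coeff_le_two_pow`)
  and the rank-revealing termination of [GolubVanLoan2013, §4.2.8, (4.2.16)–(4.2.17)]
  (`IsDiagPivoted.exists_cons`, `IsDiagPivoted.crossInterp_ne_self_iff`: the process continues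
  exactly while the number of pivots is below `rank A`).
* MAXIMUM VOLUME IS PRINCIPAL [CortinovisKressnerMassei2020, Theorem 1]: for SPSD `A` and any
  `k × k` submatrix, `det A[r, c]² ≤ det A[r, r] · det A[c, c]` (`det_submatrix_sq_le`), hence
  `|det A[r, c]| ≤ max (det A[r, r]) (det A[c, c])` and a maximum volume `k × k` submatrix can be
  chosen principal (`exists_principal_volume_maximal`); the printed proof uses a Cholesky factor
  and the singular value product inequality, the proof here is SVD-free (Schur complement
  [HornJohnson2013, (7.7.5)] plus the monotonicity of `det` on the PSD cone,
  `Literature.LinearAlgebra.Matrix.det_le_det_add_of_posSemidef`; the singular case by the kernel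
  argument of [HornJohnson2013, Observation 7.1.6]).  Composed with the maximal-volume error
  bound `Literature.LinearAlgebra.Matrix.abs_sub_crossInterp_le_of_volume_maximal`
  ([GoreinovTyrtyshnikov2011], [Savostyanov2014, (6)]): a principal pivot block of maximal volume
  AMONG PRINCIPAL BLOCKS already gives `|(A - Ã) i j| ≤ (k+1)² δ` for every rank-`≤ k` matrix
  `F` with `max |A - F| ≤ δ` (`abs_sub_crossInterp_le_of_principal_volume_maximal`).  The
  indefinite counterexample `[[0, 1], [1, 0]]` of [CortinovisKressnerMassei2020, §2.1] is
  `not_principal_volume_maximal_indefinite`.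

Relation to the tensor-train / TCI lane: these are statements about Gram-type (kernel, moment,
covariance) matrices, where pivoted Cholesky = ACA with diagonal search is the cross
approximation of choice; they do not concern unfoldings of a general tensor, which are not
symmetric.  NOT formalised: the a priori bounds of [CortinovisKressnerMassei2020, Theorems 6, 7,
Corollaries 8–10] (`‖A - Ã‖_max ≤ 4^m ρ_m σ_{m+1}(A)`, resp. `4^m σ_{m+1}(A)` for SPSD matrices
[HarbrechtPetersSchneider2012]) — Mathlib has no singular values, and the triangular-inverse
growth estimate behind `4^m` is not attempted here; the diagonally dominant case
[CortinovisKressnerMassei2020, Theorem 4, §3.4]; trace-class / eigenvalue-decay convergence rates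
of pivoted Cholesky [HarbrechtPetersSchneider2012]; any search procedure (the predicate
`IsDiagPivoted` records the outcome of a diagonal search, not an algorithm).  Theorem numbers of
[CortinovisKressnerMassei2020] follow arXiv:1902.02283.

References: A. Cortinovis, D. Kressner, S. Massei, *On maximum volume submatrices and cross
approximation for symmetric semidefinite and diagonally dominant matrices*, Linear Algebra Appl.
593 (2020) 251–268 (arXiv:1902.02283), Theorem 1, Remark 5, §3.2; G. H. Golub, C. F. Van Loan,
*Matrix Computations*, 4th ed., JHU Press 2013, §4.2.7–§4.2.8 (Algorithm 4.2.2, Theorem 4.2.8,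
(4.2.12)–(4.2.17)); R. A. Horn, C. R. Johnson, *Matrix Analysis*, 2nd ed., CUP 2013,
Observations 7.1.2, 7.1.6, 7.1.10, Corollary 7.1.5, Problem 7.1.P1, (7.7.5), Theorem 7.7.7,
Corollary 7.7.4 (e);
H. Harbrecht, M. Peters, R. Schneider, *On the low-rank approximation by the pivoted Cholesky
decomposition*, Appl. Numer. Math. 62 (2012) 428–440 (cited as attributed by
[CortinovisKressnerMassei2020, §3.2]; not consulted directly).
AI-produced formalisation (H21 engines group, seat eng-quad-2, 2026-08-21); no facts, no axioms
beyond Mathlib's, no `sorry`.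
-/

open Matrix Finset

namespace Literature.LinearAlgebra.Matrix

/-! ## Diagonally pivoted sequences (the predicate; any ordered commutative ring) -/

section General

variable {K : Type*} [CommRing K] [LE K] {n : Type*}

/-- [cite: GolubVanLoan2013, §4.2.7–§4.2.8 Algorithm 4.2.2 (outer-product `LDLᵀ` with symmetric
pivoting)]; [cite: CortinovisKressnerMassei2020, §3 Algorithm 1 with Remark 5 (pivot search
restricted to the diagonal)]
DIAGONALLY PIVOTED pivot sequences `r : Fin k → n` (newest pivot first, `vecCons`): each new
principal pivot `p` has nonzero residual diagonal `(A - Ã) p p` and maximises the current residual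
diagonal, `(A - Ã) x x ≤ (A - Ã) p p` for all `x` — pivoted Cholesky / ACA with diagonal search.
The predicate records the outcome of the search, not a procedure. -/
inductive IsDiagPivoted (A : Matrix n n K) : ∀ {k : ℕ}, (Fin k → n) → Prop
  /-- The empty pivot sequence is diagonally pivoted.
  [cite: GolubVanLoan2013, §4.2.7 Algorithm 4.2.2] -/
  | nil : IsDiagPivoted A ![]
  /-- Adjoining a principal pivot `p` with `0 ≠ (A - Ã) p p = max_x (A - Ã) x x`.
  [cite: GolubVanLoan2013, §4.2.7 Algorithm 4.2.2] -/
  | cons {k : ℕ} {r : Fin k → n} {p : n} :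
      IsDiagPivoted A r → (A - crossInterp A r r) p p ≠ 0 →
      (∀ x, (A - crossInterp A r r) x x ≤ (A - crossInterp A r r) p p) →
      IsDiagPivoted A (vecCons p r)

end General

/-! ## Entry inequalities for real positive semidefinite matrices -/

section Entries

variable {n : Type*} {A : Matrix n n ℝ}

/-- The binary quadratic form of a PSD matrix on `t e_i + e_j` is nonnegative:
`0 ≤ A i i t² + 2 A i j t + A j j` ([cite: GolubVanLoan2013, §4.2.8 Theorem 4.2.8 (proof:
"set `x = τ e_i + e_j`")]; [cite: HornJohnson2013, §7.1 Observation 7.1.2 (the principal `2 × 2`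
submatrix on `{i, j}` is PSD)]). -/
theorem quadForm_two_nonneg_of_posSemidef (hA : A.PosSemidef) (i j : n) (t : ℝ) :
    0 ≤ A i i * (t * t) + 2 * A i j * t + A j j := by
  have h := (hA.submatrix ![i, j]).dotProduct_mulVec_nonneg ![t, 1]
  have hs : A j i = A i j := by simpa using hA.1.apply i j
  simp [dotProduct, mulVec, Fin.sum_univ_two] at h
  rw [hs] at h
  nlinarith [h]

/-- [cite: GolubVanLoan2013, §4.2.8 Theorem 4.2.8 (4.2.13) (proof: "the discriminant
`4a_ij² - 4a_ii a_jj` must be negative")]; [cite: HornJohnson2013, §7.1 Problem 7.1.P1]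
`|a_ij|² ≤ a_ii a_jj` for a positive semidefinite matrix. -/
theorem sq_apply_le_diag_mul_diag (hA : A.PosSemidef) (i j : n) :
    A i j ^ 2 ≤ A i i * A j j := by
  have h := discrim_le_zero (quadForm_two_nonneg_of_posSemidef hA i j)
  rw [discrim] at h
  nlinarith [h]

/-- [cite: GolubVanLoan2013, §4.2.8 Theorem 4.2.8 (4.2.12)] `|a_ij| ≤ (a_ii + a_jj)/2` for a
positive semidefinite matrix. -/
theorem two_mul_abs_apply_le_diag_add_diag (hA : A.PosSemidef) (i j : n) :
    2 * |A i j| ≤ A i i + A j j := by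
  have h1 := quadForm_two_nonneg_of_posSemidef hA i j 1
  have h2 := quadForm_two_nonneg_of_posSemidef hA i j (-1)
  rcases abs_choice (A i j) with h | h <;> rw [h] <;> nlinarith [h1, h2]

/-- [cite: GolubVanLoan2013, §4.2.8 Theorem 4.2.8 (4.2.14)] The entry of largest modulus of a
positive semidefinite matrix is on the diagonal: `|a_ij| ≤ max (a_ii) (a_jj)`. -/
theorem abs_apply_le_max_diag (hA : A.PosSemidef) (i j : n) :
    |A i j| ≤ max (A i i) (A j j) := by
  have h := two_mul_abs_apply_le_diag_add_diag hA i j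
  have h1 := le_max_left (A i i) (A j j)
  have h2 := le_max_right (A i i) (A j j)
  linarith

/-- [cite: GolubVanLoan2013, §4.2.8 Theorem 4.2.8 (4.2.14)] A diagonal entry dominating the
diagonal dominates every entry: `max_{ij} |a_ij| = max_i a_ii`. -/
theorem abs_apply_le_of_forall_diag_le (hA : A.PosSemidef) {p : n} (hp : ∀ x, A x x ≤ A p p)
    (i j : n) : |A i j| ≤ A p p :=
  (abs_apply_le_max_diag hA i j).trans (max_le (hp i) (hp j))

/-- [cite: GolubVanLoan2013, §4.2.8 Theorem 4.2.8 (4.2.14)] Some diagonal entry of a positive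
semidefinite matrix dominates the modulus of every entry. -/
theorem exists_forall_abs_apply_le_diag [Finite n] [Nonempty n] (hA : A.PosSemidef) :
    ∃ p, ∀ i j, |A i j| ≤ A p p := by
  obtain ⟨p, hp⟩ := Finite.exists_max fun x => A x x
  exact ⟨p, abs_apply_le_of_forall_diag_le hA hp⟩

/-- [cite: GolubVanLoan2013, §4.2.8 Theorem 4.2.8 ((4.2.14) with `a_ii ≥ 0`)];
[cite: HornJohnson2013, §7.1 Corollary 7.1.5] Every entry of a positive semidefinite matrix is
bounded by the trace: `|a_ij| ≤ tr A` (the trace of the residual is the error measure of pivoted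
Cholesky, [HarbrechtPetersSchneider2012] as reported in [CortinovisKressnerMassei2020, §3.2]). -/
theorem abs_apply_le_trace [Fintype n] (hA : A.PosSemidef) (i j : n) : |A i j| ≤ A.trace := by
  have hd : ∀ x, A x x ≤ A.trace := fun x =>
    Finset.single_le_sum (f := fun y => A y y) (fun y _ => hA.diag_nonneg) (Finset.mem_univ x)
  exact (abs_apply_le_max_diag hA i j).trans (max_le (hd i) (hd j))

/-- [cite: GolubVanLoan2013, §4.2.8 Theorem 4.2.8 (4.2.15)]; [cite: HornJohnson2013, §7.1
Observation 7.1.10] A zero diagonal entry of a positive semidefinite matrix forces its whole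
row and column to vanish. -/
theorem apply_eq_zero_of_diag_eq_zero (hA : A.PosSemidef) {i : n} (hi : A i i = 0) (j : n) :
    A i j = 0 ∧ A j i = 0 := by
  have h1 := sq_apply_le_diag_mul_diag hA i j
  have h2 := sq_apply_le_diag_mul_diag hA j i
  rw [hi, zero_mul] at h1
  rw [hi, mul_zero] at h2
  exact ⟨pow_eq_zero_iff two_ne_zero |>.mp (le_antisymm h1 (sq_nonneg _)),
    pow_eq_zero_iff two_ne_zero |>.mp (le_antisymm h2 (sq_nonneg _))⟩

/-- [cite: GolubVanLoan2013, §4.2.8 Theorem 4.2.8 (4.2.15) and (4.2.17) ("`A_k` has a zero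
diagonal … `A_k = 0`")] A positive semidefinite matrix with zero diagonal is zero. -/
theorem eq_zero_of_forall_diag_eq_zero (hA : A.PosSemidef) (h : ∀ i, A i i = 0) : A = 0 := by
  ext i j
  exact (apply_eq_zero_of_diag_eq_zero hA (h i) j).1

/-- [cite: GolubVanLoan2013, §4.2.8 (4.2.16) ("`d_k > 0`")] A nonzero positive
semidefinite matrix has a positive diagonal entry (so a diagonal pivot is available). -/
theorem exists_diag_pos_of_ne_zero (hA : A.PosSemidef) (h : A ≠ 0) : ∃ p, 0 < A p p := by
  by_contra hne
  push Not at hne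
  exact h (eq_zero_of_forall_diag_eq_zero hA fun i => le_antisymm (hne i) hA.diag_nonneg)

end Entries

/-! ## Principal minors and maximum volume: [CortinovisKressnerMassei2020, Theorem 1] -/

section Volume

variable {n ι : Type*} [Fintype ι] [DecidableEq ι] {A : Matrix n n ℝ}

omit [Fintype ι] [DecidableEq ι] in
/-- The principal block on the rows and columns `(r, c)`: for a Hermitian `A`,
`A[(r, c), (r, c)]` is the block matrix `[[A[r, r], A[r, c]], [A[r, c]ᴴ, A[c, c]]]`.
[cite: HornJohnson2013, §7.7 (7.7.5) (set-up)] -/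
theorem submatrix_sumElim_sumElim_eq_fromBlocks {κ : Type*} (hA : A.IsHermitian) (r : ι → n)
    (c : κ → n) : A.submatrix (Sum.elim r c) (Sum.elim r c) =
      Matrix.fromBlocks (A.submatrix r r) (A.submatrix r c) (A.submatrix r c)ᴴ
        (A.submatrix c c) := by
  ext (i | i) (j | j)
  · rfl
  · rfl
  · simpa using (hA.apply (c i) (r j)).symm
  · rfl

/-- [cite: HornJohnson2013, §7.1 Observation 7.1.2, Corollary 7.1.5 (principal submatrices of a
PSD matrix are PSD; PSD matrices have nonnegative determinant)] Principal minors of an SPSD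
matrix are nonnegative (so the volume of a principal block is its determinant). -/
theorem det_submatrix_self_nonneg (hA : A.PosSemidef) (r : ι → n) :
    0 ≤ (A.submatrix r r).det :=
  (hA.submatrix r).det_nonneg

/-- [cite: CortinovisKressnerMassei2020, §2.1 Theorem 1 (proof: `det(A(I,J))² ≤ det A(I,I) ·
det A(J,J)`)] For an SPSD matrix and any two index lists `r, c` of the same length,
`det A[r, c]² ≤ det A[r, r] · det A[c, c]`.  Proof here (SVD-free): if `A[r, r]` is singular, a
kernel vector `v` of it satisfies `(v, 0)ᵀ M (v, 0) = 0` for the PSD block `M = A[(r,c), (r,c)]`,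
hence `M (v, 0) = 0` [cite: HornJohnson2013, §7.1 Observation 7.1.6], whose lower half reads
`A[c, r] v = 0`, so `det A[r, c] = 0`; otherwise the Schur complement
`A[c, c] - A[c, r] A[r, r]⁻¹ A[r, c]` is PSD [cite: HornJohnson2013, §7.7 (7.7.5)] and
`det A[c, c] ≥ det (A[c, r] A[r, r]⁻¹ A[r, c]) = det A[r, c]² / det A[r, r]` by the monotonicity
of `det` on the PSD cone [cite: HornJohnson2013, §7.7 Corollary 7.7.4 (e)]. -/
theorem det_submatrix_sq_le (hA : A.PosSemidef) (r c : ι → n) :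
    (A.submatrix r c).det ^ 2 ≤ (A.submatrix r r).det * (A.submatrix c c).det := by
  have hM : (Matrix.fromBlocks (A.submatrix r r) (A.submatrix r c) (A.submatrix r c)ᴴ
      (A.submatrix c c)).PosSemidef := by
    rw [← submatrix_sumElim_sumElim_eq_fromBlocks hA.1 r c]
    exact hA.submatrix _
  by_cases hP : (A.submatrix r r).det = 0
  · -- singular principal block: `det A[r, c] = 0`
    obtain ⟨v, hv, hPv⟩ := Matrix.exists_mulVec_eq_zero_iff.mpr hP
    have hq : star (Sum.elim v 0) ⬝ᵥ (Matrix.fromBlocks (A.submatrix r r) (A.submatrix r c)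
        (A.submatrix r c)ᴴ (A.submatrix c c)) *ᵥ Sum.elim v 0 = 0 := by
      rw [fromBlocks_mulVec]
      simp [hPv]
    have hw := (hM.dotProduct_mulVec_zero_iff _).mp hq
    rw [fromBlocks_mulVec] at hw
    have hBv : (A.submatrix r c)ᴴ *ᵥ v = 0 := by
      have h2 := congr_arg (fun w => w ∘ Sum.inr) hw
      simpa [hPv] using h2
    have hdet : ((A.submatrix r c)ᴴ).det = 0 :=
      Matrix.exists_mulVec_eq_zero_iff.mp ⟨v, hv, hBv⟩
    rw [det_conjTranspose, star_trivial] at hdet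
    rw [hdet, hP]
    simp
  · -- nonsingular principal block: Schur complement
    have hPd : (A.submatrix r r).PosDef := (hA.submatrix r).posDef_iff_det_ne_zero.mpr hP
    letI : Invertible (A.submatrix r r) := hPd.isUnit.invertible
    have hS := (Matrix.PosDef.fromBlocks₁₁ (A.submatrix r c) (A.submatrix c c) hPd).mp hM
    have hY : ((A.submatrix r c)ᴴ * (A.submatrix r r)⁻¹ * A.submatrix r c).PosSemidef :=
      hPd.inv.posSemidef.conjTranspose_mul_mul_same _
    have hdet := det_le_det_add_of_posSemidef hY hS
    rw [add_sub_cancel, det_mul, det_mul, det_conjTranspose, star_trivial, det_nonsing_inv,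
      Ring.inverse_eq_inv] at hdet
    have hPpos : 0 < (A.submatrix r r).det := hPd.det_pos
    have h2 := mul_le_mul_of_nonneg_left hdet hPpos.le
    calc (A.submatrix r c).det ^ 2
        = (A.submatrix r r).det * ((A.submatrix r c).det * ((A.submatrix r r).det)⁻¹ *
            (A.submatrix r c).det) := by
          field_simp
      _ ≤ (A.submatrix r r).det * (A.submatrix c c).det := h2

/-- [cite: CortinovisKressnerMassei2020, §2.1 Theorem 1 ("the volume of `A(I,J)` is not larger
than the maximum of the volumes of `A(I,I)` and `A(J,J)`")] -/
theorem abs_det_submatrix_le_max (hA : A.PosSemidef) (r c : ι → n) :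
    |(A.submatrix r c).det| ≤ max (A.submatrix r r).det (A.submatrix c c).det := by
  have h := det_submatrix_sq_le hA r c
  have hr := det_submatrix_self_nonneg hA r
  have hc := det_submatrix_self_nonneg hA c
  have hM : 0 ≤ max (A.submatrix r r).det (A.submatrix c c).det := hr.trans (le_max_left _ _)
  have hpq : (A.submatrix r r).det * (A.submatrix c c).det ≤
      max (A.submatrix r r).det (A.submatrix c c).det ^ 2 := by
    rw [sq]
    exact mul_le_mul (le_max_left _ _) (le_max_right _ _) hc hM
  have h2 := sq_le_sq.mp (h.trans hpq)
  rwa [abs_of_nonneg hM] at h2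

/-- [cite: CortinovisKressnerMassei2020, §2.1 Theorem 1] A principal block whose volume is
maximal AMONG PRINCIPAL BLOCKS of its size has maximal volume among ALL blocks of its size (the
hypothesis `hmax` of `Literature.LinearAlgebra.Matrix.abs_sub_crossInterp_le_of_volume_maximal`
for an SPSD matrix only needs to be checked on the diagonal of the index lattice). -/
theorem abs_det_submatrix_le_of_forall_principal_le (hA : A.PosSemidef) {r : ι → n}
    (hmax : ∀ r' : ι → n, (A.submatrix r' r').det ≤ (A.submatrix r r).det) (r' c' : ι → n) :
    |(A.submatrix r' c').det| ≤ |(A.submatrix r r).det| :=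
  (abs_det_submatrix_le_max hA r' c').trans ((max_le (hmax r') (hmax c')).trans (le_abs_self _))

/-- [cite: CortinovisKressnerMassei2020, §2.1 Theorem 1 ("Let `A ∈ ℝ^{n×n}` be SPSD and let
`1 ≤ k ≤ n`. Then the maximum volume `k × k` submatrix of `A` can be chosen to be a principal
submatrix.")] -/
theorem exists_principal_volume_maximal [Finite n] [Nonempty n] (hA : A.PosSemidef) :
    ∃ r : ι → n, ∀ r' c' : ι → n, |(A.submatrix r' c').det| ≤ (A.submatrix r r).det := by
  obtain ⟨r, hr⟩ := Finite.exists_max fun r : ι → n => (A.submatrix r r).det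
  exact ⟨r, fun r' c' => (abs_det_submatrix_le_max hA r' c').trans (max_le (hr r') (hr c'))⟩

/-- [cite: CortinovisKressnerMassei2020, §2.1 (after Theorem 1: "it does not extend to the
indefinite case; consider for example the `2k × 2k` matrix `[[0, I], [I, 0]]`")] The case
`k = 1`: the symmetric indefinite matrix `[[0, 1], [1, 0]]` has all principal `1 × 1` minors zero
but an off-diagonal entry of modulus one. -/
theorem not_principal_volume_maximal_indefinite :
    (!![0, 1; 1, 0] : Matrix (Fin 2) (Fin 2) ℝ).IsSymm ∧
      ¬ |((!![0, 1; 1, 0] : Matrix (Fin 2) (Fin 2) ℝ).submatrix ![0] ![1]).det| ≤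
        max ((!![0, 1; 1, 0] : Matrix (Fin 2) (Fin 2) ℝ).submatrix ![0] ![0]).det
          ((!![0, 1; 1, 0] : Matrix (Fin 2) (Fin 2) ℝ).submatrix ![1] ![1]).det := by
  refine ⟨?_, ?_⟩
  · ext i j
    fin_cases i <;> fin_cases j <;> rfl
  · norm_num [Matrix.det_fin_one]

end Volume

/-! ## The principal cross approximation of an SPSD matrix: `0 ≼ Ã ≼ A` -/

section Principal

variable {n ι : Type*} [Fintype n] [Fintype ι] [DecidableEq ι] {A : Matrix n n ℝ}

/-- [cite: CortinovisKressnerMassei2020, §3 Remark 5 ("if `A` is an SPSD matrix then the cross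
approximation `A(:,I)A(I,I)⁻¹A(I,:)` … is SPSD")] The cross approximation of an SPSD matrix on a
PRINCIPAL pivot block is positive semidefinite: `Ã = C P⁻¹ Cᵀ` with `P⁻¹ = (A[r, r])⁻¹ ≽ 0`
(no nonsingularity needed: Mathlib's `P⁻¹ = 0` for singular `P`). -/
theorem posSemidef_crossInterp_self (hA : A.PosSemidef) (r : ι → n) :
    (crossInterp A r r).PosSemidef := by
  have hC : A.submatrix r id = (A.submatrix id r)ᴴ := by
    rw [conjTranspose_submatrix, hA.1.eq]
  rw [crossInterp_def, hC]
  exact (hA.submatrix r).inv.mul_mul_conjTranspose_same _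

/-- [cite: HornJohnson2013, §7.7 (7.7.5) ("`H = [[A, B], [B^*, C]]` … is positive semidefinite
if and only if `A ≻ 0` and `C - B^* A⁻¹ B ⪰ 0`", for a nonsingular leading block `A`; the
definite case is Theorem 7.7.7 (a)⇔(b))]; [cite: CortinovisKressnerMassei2020, §3 Remark 5
("positive definiteness … preserved by taking Schur complements")]; [cite: GolubVanLoan2013,
§4.2.8 (4.2.16) ("since `A_k` is positive semidefinite")]
THE RESIDUAL OF A PRINCIPAL CROSS APPROXIMATION OF AN SPSD MATRIX IS SPSD: for `A ≽ 0` and a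
nonsingular principal pivot block `A[r, r]`, `A - A[:, r] A[r, r]⁻¹ A[r, :] ≽ 0`.  Together with
`posSemidef_crossInterp_self`: `0 ≼ Ã ≼ A` in the Loewner order. -/
theorem posSemidef_sub_crossInterp (hA : A.PosSemidef) (r : ι → n)
    (hP : IsUnit (A.submatrix r r).det) : (A - crossInterp A r r).PosSemidef := by
  have hPd : (A.submatrix r r).PosDef :=
    (hA.submatrix r).posDef_iff_det_ne_zero.mpr hP.ne_zero
  letI : Invertible (A.submatrix r r) := hPd.isUnit.invertible
  have hM : (Matrix.fromBlocks (A.submatrix r r) (A.submatrix r id) (A.submatrix r id)ᴴ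
      (A.submatrix id id)).PosSemidef := by
    rw [← submatrix_sumElim_sumElim_eq_fromBlocks hA.1 r id]
    exact hA.submatrix _
  rw [Matrix.submatrix_id_id] at hM
  have h := (Matrix.PosDef.fromBlocks₁₁ (A.submatrix r id) A hPd).mp hM
  rwa [conjTranspose_submatrix, hA.1.eq, ← crossInterp_def] at h

/-! ### The diagonal certificate for the residual `S = A - Ã` -/

/-- [cite: GolubVanLoan2013, §4.2.8 (4.2.16) (`A_k` is PSD, `d_k ≥ 0`)] The residual
diagonals `d_x = (A - Ã) x x` of a principal cross approximation are nonnegative. -/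
theorem sub_crossInterp_diag_nonneg (hA : A.PosSemidef) (r : ι → n)
    (hP : IsUnit (A.submatrix r r).det) (x : n) : 0 ≤ (A - crossInterp A r r) x x :=
  (posSemidef_sub_crossInterp hA r hP).diag_nonneg

/-- [cite: CortinovisKressnerMassei2020, §3 Remark 5]; [cite: GolubVanLoan2013, §4.2.8
Theorem 4.2.8] `0 ≤ Ã x x ≤ A x x`: the diagonal of the principal cross approximation is
sandwiched between `0` and the diagonal of `A`. -/
theorem crossInterp_self_diag_nonneg_and_le (hA : A.PosSemidef) (r : ι → n)
    (hP : IsUnit (A.submatrix r r).det) (x : n) :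
    0 ≤ crossInterp A r r x x ∧ crossInterp A r r x x ≤ A x x := by
  refine ⟨(posSemidef_crossInterp_self hA r).diag_nonneg, ?_⟩
  have h := sub_crossInterp_diag_nonneg hA r hP x
  rw [Matrix.sub_apply] at h
  linarith

/-- [cite: GolubVanLoan2013, §4.2.8 Theorem 4.2.8 (4.2.13) (applied to the PSD residual
`A_k`)] `((A - Ã) i j)² ≤ (A - Ã) i i · (A - Ã) j j`. -/
theorem sq_sub_crossInterp_le_diag_mul_diag (hA : A.PosSemidef) (r : ι → n)
    (hP : IsUnit (A.submatrix r r).det) (i j : n) :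
    (A - crossInterp A r r) i j ^ 2 ≤
      (A - crossInterp A r r) i i * (A - crossInterp A r r) j j :=
  sq_apply_le_diag_mul_diag (posSemidef_sub_crossInterp hA r hP) i j

/-- [cite: GolubVanLoan2013, §4.2.8 Theorem 4.2.8 (4.2.14) (applied to the PSD residual)];
[cite: CortinovisKressnerMassei2020, §3 Remark 5 ("the element of maximum modulus is on the
diagonal … preserved by taking Schur complements")]
THE DIAGONAL CERTIFICATE: every entry of the residual of a principal cross approximation of an
SPSD matrix is bounded by the larger of the two residual diagonals it meets,
`|(A - Ã) i j| ≤ max ((A - Ã) i i) ((A - Ã) j j)`. -/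
theorem abs_sub_crossInterp_le_max_diag (hA : A.PosSemidef) (r : ι → n)
    (hP : IsUnit (A.submatrix r r).det) (i j : n) :
    |(A - crossInterp A r r) i j| ≤
      max ((A - crossInterp A r r) i i) ((A - crossInterp A r r) j j) :=
  abs_apply_le_max_diag (posSemidef_sub_crossInterp hA r hP) i j

/-- [cite: GolubVanLoan2013, §4.2.8 Theorem 4.2.8 (4.2.14)]; [cite: CortinovisKressnerMassei2020,
§3 Remark 5] The Chebyshev error of a principal cross approximation of an SPSD matrix is read
off the residual diagonal: if `(A - Ã) x x ≤ ε` for all `x` then `|(A - Ã) i j| ≤ ε` for all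
`i, j` (only the `n` diagonal residuals need to be evaluated). -/
theorem abs_sub_crossInterp_le_of_diag_le (hA : A.PosSemidef) (r : ι → n)
    (hP : IsUnit (A.submatrix r r).det) {ε : ℝ} (hε : ∀ x, (A - crossInterp A r r) x x ≤ ε)
    (i j : n) : |(A - crossInterp A r r) i j| ≤ ε :=
  (abs_sub_crossInterp_le_max_diag hA r hP i j).trans (max_le (hε i) (hε j))

/-- [cite: GolubVanLoan2013, §4.2.8 Theorem 4.2.8 (4.2.14)]; [cite: CortinovisKressnerMassei2020,
§3 Remark 5] The pivot form of the certificate: a residual diagonal `(A - Ã) p p` dominating the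
residual diagonal dominates the whole residual, `|(A - Ã) i j| ≤ (A - Ã) p p` — a diagonal pivot
is a complete (full) pivot. -/
theorem abs_sub_crossInterp_le_pivot_of_forall_diag_le (hA : A.PosSemidef) (r : ι → n)
    (hP : IsUnit (A.submatrix r r).det) {p : n}
    (hmax : ∀ x, (A - crossInterp A r r) x x ≤ (A - crossInterp A r r) p p) (i j : n) :
    |(A - crossInterp A r r) i j| ≤ (A - crossInterp A r r) p p :=
  abs_apply_le_of_forall_diag_le (posSemidef_sub_crossInterp hA r hP) hmax i j

/-- [cite: CortinovisKressnerMassei2020, §3.2 (pivoted Cholesky of [HarbrechtPetersSchneider2012]: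
the trace of the Schur complement controls the error)]; [cite: GolubVanLoan2013, §4.2.8
Theorem 4.2.8 (4.2.14)] The trace certificate: `|(A - Ã) i j| ≤ tr (A - Ã) = Σ_x d_x`. -/
theorem abs_sub_crossInterp_le_trace (hA : A.PosSemidef) (r : ι → n)
    (hP : IsUnit (A.submatrix r r).det) (i j : n) :
    |(A - crossInterp A r r) i j| ≤ (A - crossInterp A r r).trace :=
  abs_apply_le_trace (posSemidef_sub_crossInterp hA r hP) i j

/-- [cite: CortinovisKressnerMassei2020, §3.2 ("in the SPSD case … one obtains `ρ_k = 1`")];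
[cite: GolubVanLoan2013, §4.2.8 Theorem 4.2.8] GROWTH FACTOR ONE: the residual of a principal
cross approximation of an SPSD matrix is entrywise bounded by the diagonal of `A` itself,
`|(A - Ã) i j| ≤ max (A i i) (A j j) ≤ max_x A x x = max |A|`. -/
theorem abs_sub_crossInterp_le_max_diag_self (hA : A.PosSemidef) (r : ι → n)
    (hP : IsUnit (A.submatrix r r).det) (i j : n) :
    |(A - crossInterp A r r) i j| ≤ max (A i i) (A j j) := by
  refine (abs_sub_crossInterp_le_max_diag hA r hP i j).trans (max_le_max ?_ ?_)
  · have h := (crossInterp_self_diag_nonneg_and_le hA r hP i).1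
    rw [Matrix.sub_apply]
    linarith
  · have h := (crossInterp_self_diag_nonneg_and_le hA r hP j).1
    rw [Matrix.sub_apply]
    linarith

/-- [cite: GolubVanLoan2013, §4.2.8 Theorem 4.2.8 (4.2.15) and (4.2.17)] EXACTNESS READ OFF THE
DIAGONAL: if every residual diagonal of a principal cross approximation of an SPSD matrix
vanishes, the approximation is exact, `Ã = A`. -/
theorem crossInterp_eq_self_of_forall_diag_eq_zero (hA : A.PosSemidef) (r : ι → n)
    (hP : IsUnit (A.submatrix r r).det) (h : ∀ x, (A - crossInterp A r r) x x = 0) :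
    crossInterp A r r = A :=
  (sub_eq_zero.mp (eq_zero_of_forall_diag_eq_zero (posSemidef_sub_crossInterp hA r hP) h)).symm

/-- [cite: GolubVanLoan2013, §4.2.8 (4.2.16) ("`d_k > 0`")] NO BREAKDOWN: while a
principal cross approximation of an SPSD matrix is not yet exact, some residual diagonal is
positive — a further diagonal pivot with nonzero (indeed positive) residual is available. -/
theorem exists_sub_crossInterp_diag_pos (hA : A.PosSemidef) (r : ι → n)
    (hP : IsUnit (A.submatrix r r).det) (h : crossInterp A r r ≠ A) :
    ∃ p, 0 < (A - crossInterp A r r) p p :=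
  exists_diag_pos_of_ne_zero (posSemidef_sub_crossInterp hA r hP) (sub_ne_zero.mpr h.symm)

/-! ### Maximal principal volume gives the `(k+1)²` Chebyshev bound -/

/-- [cite: CortinovisKressnerMassei2020, §2.1 Theorem 1 (with the maximal-volume bound
(eq. (2)) it motivates)]; [cite: Savostyanov2014, §2 eq. (6)]; [cite: GoreinovTyrtyshnikov2011,
§1] THE MAXIMUM-VOLUME PRINCIPLE FOR SPSD MATRICES, Chebyshev form: if the principal pivot block
`A[r, r]` (`k = card ι` pivots) is nonsingular and has maximal volume AMONG PRINCIPAL `k × k`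
BLOCKS, then for every matrix `F` of rank `≤ k` with `|A i j - F i j| ≤ δ`,
`|(A - A[:, r] A[r, r]⁻¹ A[r, :]) i j| ≤ (k+1)² δ` — [CortinovisKressnerMassei2020, Theorem 1]
composed with `Literature.LinearAlgebra.Matrix.abs_sub_crossInterp_le_of_volume_maximal` (the
spectral-norm version `≤ (k+1) σ_{k+1}(A)` of [GoreinovTyrtyshnikov2001] printed in
[CortinovisKressnerMassei2020, eq. (2)] is not formalised: no singular values). -/
theorem abs_sub_crossInterp_le_of_principal_volume_maximal (hA : A.PosSemidef) (r : ι → n)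
    (hP : IsUnit (A.submatrix r r).det)
    (hmax : ∀ r' : ι → n, (A.submatrix r' r').det ≤ (A.submatrix r r).det)
    (F : Matrix n n ℝ) (hF : F.rank ≤ Fintype.card ι) {δ : ℝ} (hδ : ∀ i j, |A i j - F i j| ≤ δ)
    (i j : n) : |(A - crossInterp A r r) i j| ≤ (Fintype.card ι + 1 : ℝ) ^ 2 * δ :=
  abs_sub_crossInterp_le_of_volume_maximal A r r hP
    (abs_det_submatrix_le_of_forall_principal_le hA hmax) F hF hδ i j

end Principal

/-! ## One more diagonal pivot: the residual diagonal and the pivots are non-increasing -/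

section DiagonalStep

variable {n : Type*} [Fintype n] {A : Matrix n n ℝ} {k : ℕ}

/-- [cite: GolubVanLoan2013, §4.2.7–§4.2.8 (the outer-product update behind Algorithm 4.2.2,
restricted to the diagonal)]; [cite: CortinovisKressnerMassei2020, §3 Algorithm 1 (line 5:
`R_k ← R_{k-1} - R_{k-1}(:, j_k) R_{k-1}(i_k, :) / p_k`) with Remark 5] ONE MORE PRINCIPAL PIVOT
`p` (current residual `S = A - Ã`, `S p p ≠ 0`): the new residual diagonal is
`S' x x = S x x - (S x p)² / S p p` (the ACA update
`Literature.LinearAlgebra.Matrix.sub_crossInterp_vecCons_vecCons_apply` on the diagonal, using the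
symmetry of `S`). -/
theorem sub_crossInterp_vecCons_self_diag_eq (hA : A.PosSemidef) (r : Fin k → n)
    (hP : IsUnit (A.submatrix r r).det) {p : n} (hp : (A - crossInterp A r r) p p ≠ 0) (x : n) :
    (A - crossInterp A (vecCons p r) (vecCons p r)) x x = (A - crossInterp A r r) x x -
      (A - crossInterp A r r) x p ^ 2 / (A - crossInterp A r r) p p := by
  have hs : (A - crossInterp A r r) p x = (A - crossInterp A r r) x p := by
    simpa using (posSemidef_sub_crossInterp hA r hP).1.apply x p
  rw [sub_crossInterp_vecCons_vecCons_apply A r r hP (isUnit_iff_ne_zero.mpr hp), hs,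
    Ring.inverse_eq_inv, div_eq_mul_inv, sq]
  ring

/-- [cite: GolubVanLoan2013, §4.2.7–§4.2.8 Theorem 4.2.8]; [cite: CortinovisKressnerMassei2020,
§3.2] The residual diagonals are NON-INCREASING under a further principal pivot:
`S' x x ≤ S x x`. -/
theorem sub_crossInterp_vecCons_self_diag_le (hA : A.PosSemidef) (r : Fin k → n)
    (hP : IsUnit (A.submatrix r r).det) {p : n} (hp : (A - crossInterp A r r) p p ≠ 0) (x : n) :
    (A - crossInterp A (vecCons p r) (vecCons p r)) x x ≤ (A - crossInterp A r r) x x := by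
  rw [sub_crossInterp_vecCons_self_diag_eq hA r hP hp x]
  have h := div_nonneg (sq_nonneg ((A - crossInterp A r r) x p))
    (sub_crossInterp_diag_nonneg hA r hP p)
  linarith

/-- [cite: CortinovisKressnerMassei2020, §3.2 ("in the SPSD case, the pivot elements of
Algorithm 1 are always non-increasing")]; [cite: GolubVanLoan2013, §4.2.7–§4.2.8] THE PIVOTS ARE
NON-INCREASING: after a diagonal pivot `p` maximising the residual diagonal, every new residual
diagonal — in particular the next pivot — is at most the old pivot `S p p`. -/
theorem sub_crossInterp_vecCons_self_diag_le_pivot (hA : A.PosSemidef) (r : Fin k → n)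
    (hP : IsUnit (A.submatrix r r).det) {p : n} (hp : (A - crossInterp A r r) p p ≠ 0)
    (hmax : ∀ x, (A - crossInterp A r r) x x ≤ (A - crossInterp A r r) p p) (x : n) :
    (A - crossInterp A (vecCons p r) (vecCons p r)) x x ≤ (A - crossInterp A r r) p p :=
  (sub_crossInterp_vecCons_self_diag_le hA r hP hp x).trans (hmax x)

/-- [cite: CortinovisKressnerMassei2020, §3.2 (`ρ_k = 1` for SPSD matrices: `‖A^{(k)}‖_max` does
not grow)]; [cite: GolubVanLoan2013, §4.2.8 Theorem 4.2.8 (4.2.14)] After a diagonal pivot `p`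
maximising the residual diagonal, the WHOLE new residual is bounded by the old pivot:
`|S' x y| ≤ S p p = max |S|`. -/
theorem abs_sub_crossInterp_vecCons_self_le_pivot (hA : A.PosSemidef) (r : Fin k → n)
    (hP : IsUnit (A.submatrix r r).det) {p : n} (hp : (A - crossInterp A r r) p p ≠ 0)
    (hmax : ∀ x, (A - crossInterp A r r) x x ≤ (A - crossInterp A r r) p p) (x y : n) :
    |(A - crossInterp A (vecCons p r) (vecCons p r)) x y| ≤ (A - crossInterp A r r) p p := by
  have hP' : IsUnit (A.submatrix (vecCons p r) (vecCons p r)).det :=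
    (isUnit_det_submatrix_vecCons_vecCons_iff A r r hP p p).mpr (isUnit_iff_ne_zero.mpr hp)
  exact (abs_sub_crossInterp_le_max_diag hA _ hP' x y).trans
    (max_le (sub_crossInterp_vecCons_self_diag_le_pivot hA r hP hp hmax x)
      (sub_crossInterp_vecCons_self_diag_le_pivot hA r hP hp hmax y))

/-- [cite: GolubVanLoan2013, §4.2.7–§4.2.8 (outer-product update)];
[cite: CortinovisKressnerMassei2020, §3.2 (the trace criterion of the pivoted Cholesky
decomposition of [HarbrechtPetersSchneider2012])] The trace of the residual after one more
principal pivot: `tr S' = tr S - Σ_x (S x p)² / S p p`. -/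
theorem trace_sub_crossInterp_vecCons_self_eq (hA : A.PosSemidef) (r : Fin k → n)
    (hP : IsUnit (A.submatrix r r).det) {p : n} (hp : (A - crossInterp A r r) p p ≠ 0) :
    (A - crossInterp A (vecCons p r) (vecCons p r)).trace = (A - crossInterp A r r).trace -
      ∑ x, (A - crossInterp A r r) x p ^ 2 / (A - crossInterp A r r) p p := by
  simp only [Matrix.trace, Matrix.diag_apply, sub_crossInterp_vecCons_self_diag_eq hA r hP hp,
    Finset.sum_sub_distrib]

/-- [cite: GolubVanLoan2013, §4.2.7–§4.2.8]; [cite: CortinovisKressnerMassei2020, §3.2] The trace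
of the residual drops by AT LEAST THE PIVOT under one more principal pivot:
`tr S' ≤ tr S - S p p` (the `x = p` term of `trace_sub_crossInterp_vecCons_self_eq` alone). -/
theorem trace_sub_crossInterp_vecCons_self_le (hA : A.PosSemidef) (r : Fin k → n)
    (hP : IsUnit (A.submatrix r r).det) {p : n} (hp : (A - crossInterp A r r) p p ≠ 0) :
    (A - crossInterp A (vecCons p r) (vecCons p r)).trace ≤
      (A - crossInterp A r r).trace - (A - crossInterp A r r) p p := by
  rw [trace_sub_crossInterp_vecCons_self_eq hA r hP hp]
  have hpp : 0 ≤ (A - crossInterp A r r) p p := sub_crossInterp_diag_nonneg hA r hP p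
  have h1 := Finset.single_le_sum
    (f := fun x => (A - crossInterp A r r) x p ^ 2 / (A - crossInterp A r r) p p)
    (fun x _ => div_nonneg (sq_nonneg _) hpp) (Finset.mem_univ p)
  have e : (A - crossInterp A r r) p p ^ 2 / (A - crossInterp A r r) p p =
      (A - crossInterp A r r) p p := by
    rw [sq, mul_div_assoc, div_self hp, mul_one]
  simp only [e] at h1
  linarith

end DiagonalStep

/-! ## Diagonally pivoted sequences: rook pivoting, nonsingular blocks, termination at the rank -/

section DiagPivoted

variable {n : Type*} [Fintype n] {A : Matrix n n ℝ} {k : ℕ} {r : Fin k → n}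

/-- [cite: CortinovisKressnerMassei2020, §3 Remark 5 ("the search for the pivot element in
Step 3 can be restricted to the diagonal for such matrices … Algorithm 1 returns `I = J`")];
[cite: NunezFernandezEtAl2025, §3.3.1 (full pivoting is rook pivoting)] DIAGONAL PIVOTING ON AN
SPSD MATRIX IS COMPLETE PIVOTING: a diagonally pivoted sequence is rook-pivoted (indeed each step
is a full-pivoting step, `IsRookPivoted.cons_of_forall`), because the maximal residual diagonal
dominates the whole PSD residual. -/
theorem IsDiagPivoted.isRookPivoted (hA : A.PosSemidef) (h : IsDiagPivoted A r) :
    IsRookPivoted A r r := by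
  induction h with
  | nil => exact .nil
  | cons _ hne hmax ih =>
    refine ih.cons_of_forall hne fun x y => ?_
    rw [Real.norm_eq_abs, Real.norm_eq_abs]
    exact (abs_sub_crossInterp_le_pivot_of_forall_diag_le hA _ ih.isColumnPivoted.isUnit_det
      hmax x y).trans (le_abs_self _)

/-- [cite: GolubVanLoan2013, §4.2.8 (4.2.16) (`d_k > 0` for `k ≤ r`, so the
leading blocks are nonsingular)]; [cite: Bebendorf2000, §2 Lemma 2] Along a diagonally pivoted
sequence on an SPSD matrix every principal pivot block `A[r, r]` is nonsingular. -/
theorem IsDiagPivoted.isUnit_det (hA : A.PosSemidef) (h : IsDiagPivoted A r) :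
    IsUnit (A.submatrix r r).det :=
  (h.isRookPivoted hA).isColumnPivoted.isUnit_det

/-- [cite: GolubVanLoan2013, §4.2.8 (4.2.16) (`A_k` is PSD)];
[cite: CortinovisKressnerMassei2020, §3 Remark 5] Along a diagonally pivoted sequence the
residual `A - Ã` is SPSD (so the diagonal certificate `abs_sub_crossInterp_le_max_diag` and the
trace certificate apply at every step). -/
theorem IsDiagPivoted.posSemidef_sub_crossInterp (hA : A.PosSemidef) (h : IsDiagPivoted A r) :
    (A - crossInterp A r r).PosSemidef :=
  Literature.LinearAlgebra.Matrix.posSemidef_sub_crossInterp hA r (h.isUnit_det hA)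

/-- [cite: Bebendorf2000, §2 Lemma 6]; [cite: NunezFernandezEtAl2025, App. B.2];
[cite: CortinovisKressnerMassei2020, §3 Remark 5] Under diagonal pivoting on an SPSD matrix both
coefficient matrices of the cross interpolation obey the `2^s` growth bound of partial
pivoting: `‖(A[:, r] P⁻¹) x s‖ ≤ 2^s` and `‖(P⁻¹ A[r, :]) s y‖ ≤ 2^s` (`s` counted from the
newest pivot). -/
theorem IsDiagPivoted.norm_coeff_le_two_pow (hA : A.PosSemidef) (h : IsDiagPivoted A r) (x : n)
    (s : Fin k) (y : n) :
    ‖(A.submatrix id r * (A.submatrix r r)⁻¹) x s‖ ≤ 2 ^ (s : ℕ) ∧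
      ‖((A.submatrix r r)⁻¹ * A.submatrix r id) s y‖ ≤ 2 ^ (s : ℕ) :=
  (h.isRookPivoted hA).norm_coeff_le_two_pow x s y

/-- [cite: GolubVanLoan2013, §4.2.8 (4.2.16) (the process can be continued while
`k ≤ r = rank A`)] CONTINUATION: while the cross approximation along a diagonally pivoted
sequence is not exact, a further diagonal pivot (maximising the residual diagonal, with positive
residual) exists. -/
theorem IsDiagPivoted.exists_cons (hA : A.PosSemidef) (h : IsDiagPivoted A r)
    (hne : crossInterp A r r ≠ A) : ∃ p, IsDiagPivoted A (vecCons p r) := by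
  obtain ⟨p₀, hp₀⟩ := exists_sub_crossInterp_diag_pos hA r (h.isUnit_det hA) hne
  haveI : Nonempty n := ⟨p₀⟩
  obtain ⟨p, hp⟩ := Finite.exists_max fun x => (A - crossInterp A r r) x x
  exact ⟨p, h.cons (hp₀.trans_le (hp p₀)).ne' hp⟩

/-- [cite: GolubVanLoan2013, §4.2.8 Theorem 4.2.8]; [cite: HornJohnson2013, §0.4.4 (d)] The
number of diagonal pivots never exceeds the rank. -/
theorem IsDiagPivoted.le_rank (hA : A.PosSemidef) (h : IsDiagPivoted A r) : k ≤ A.rank := by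
  simpa using card_le_rank_of_isUnit_det_submatrix A (h.isUnit_det hA)

/-- [cite: GolubVanLoan2013, §4.2.8 (4.2.16)–(4.2.17) (for `rank A = r`, `d_k > 0`
for `k ≤ r` and `A_r = 0`)] RANK-REVEALING TERMINATION: along a diagonally pivoted sequence of
`k` pivots on an SPSD matrix, the cross approximation is NOT yet exact if and only if
`k < rank A`; equivalently diagonal pivoting runs for exactly `rank A` steps and then the residual
vanishes (`Literature.LinearAlgebra.Matrix.crossInterp_eq_self_iff_rank_eq`). -/
theorem IsDiagPivoted.crossInterp_ne_self_iff (hA : A.PosSemidef) (h : IsDiagPivoted A r) :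
    crossInterp A r r ≠ A ↔ k < A.rank := by
  constructor
  · intro hne
    obtain ⟨p, hp⟩ := h.exists_cons hA hne
    have h1 := hp.le_rank hA
    omega
  · intro hlt heq
    have h1 := (crossInterp_eq_self_iff_rank_eq A (h.isUnit_det hA)).mp heq
    simp only [Fintype.card_fin] at h1
    omega

end DiagPivoted

end Literature.LinearAlgebra.Matrix
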